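import Mathlib
import Summits.KontsevichZagierPeriods.KontsevichZagierPeriods.Theorems.SoloInformedLegendreBand
import Summits.KontsevichZagierPeriods.KontsevichZagierPeriods.Theorems.SoloInformedLiftMoves
import Summits.KontsevichZagierPeriods.KontsevichZagierPeriods.Theorems.SoloInformedEulerLemniscate
import Literature.NumberTheory.Transcendental.KZProductIdeal
import Literature.NumberTheory.Transcendental.KZBallVolume
import Literature.NumberTheory.Transcendental.KZBetaUnitExponent
import Literature.NumberTheory.Transcendental.KZDirichletPeeling
import Literature.NumberTheory.Transcendental.KZGaussMultiplicationChain
import HarnessLib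
import HarnessLib.Audit

/-!
# Legendre's relation by moves, VI: the one-dimensional representations (solo-informed, s33)

The complete elliptic integrals as representations of the Kontsevich–Zagier calculus on `(0,1)`,
for a real algebraic parameter `m ∈ (0,1)` (`m = k²`):
`K_m = [(0,1), ((1−x²)(1−mx²))^{-1/2}]` (`soloInformed_exists_ellipticK_rep`),
`E_m = [(0,1), (1−mx²)((1−x²)(1−mx²))^{-1/2}]` (`soloInformed_exists_ellipticE_rep`), the
arcsine differential `[(0,1), (1−x²)^{-1/2}]`, and the two facts about the undeformed end of the
Legendre homotopy used by THEOREM XVII (file VII):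

* `2·⟦[(0,1), (1−x²)^{-1/2}]⟧ = ⟦[disc, 1]⟧ = ⟦π⟧` (`soloInformed_two_mul_toFormalPeriod_arcsine`):
  the substitution `u = x²` (rule 2) gives `½·⟦B(½,½)⟧`, and `⟦B(½,½)⟧ = ⟦π⟧` is the
  Euler–lemniscate theorem (s22);
* `⟦[(0,1), 1]⟧ = 1` (`soloInformed_exists_unitInterval_rep`), and the Fubini product of two
  representations on `(0,1)` (`soloInformed_prod_one_one`).

References: M. Kontsevich, D. Zagier, *Periods* (2001), §§ 1.1–1.2; E. T. Whittaker, G. N. Watson,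
*A Course of Modern Analysis* (4th ed. 1927), §§ 22.3, 22.73; this work (solo-informed s33).
-/

noncomputable section

open MeasureTheory Set Filter
open scoped Classical

open Literature.NumberTheory.Transcendental Literature.NumberTheory.Transcendental.KZ
open Literature.ModelTheory.ExponentialFields

namespace Summit.KontsevichZagierPeriods.KontsevichZagierPeriods.Theorems

/-! ### One-dimensional representations: `K_m`, `E_m`, the arcsine -/

/-- `x ↦ (1 − x²)^{-1/2}` is `ℚ`-semialgebraic on `(0,1)`. [folklore] -/
theorem soloInformed_sa_arcsine :
    IsSemialgebraicFunOn ℚ {x : Fin 1 → ℝ | x 0 ∈ Ioo (0:ℝ) 1}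
      (fun x : Fin 1 → ℝ => (√(1 - x 0 ^ 2))⁻¹) := by
  refine (soloInformed_sa_inv_sqrt_aeval BallPeeling.isSemialgebraic_posIoo
    (1 - MvPolynomial.X 0 ^ 2) fun x hx => ?_).congr fun x _ => ?_
  · simp only [map_sub, map_one, map_pow, MvPolynomial.aeval_X]
    have h : x 0 ∈ Ioo (0:ℝ) 1 := hx
    nlinarith [h.1, h.2]
  · simp only [map_sub, map_one, map_pow, MvPolynomial.aeval_X]

/-- For `m ∈ (0,1)` algebraic, `x ↦ 1 − m x²` and `x ↦ (1 − m x²)^{-1/2}` are `ℚ`-semialgebraic on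
`(0,1)`. [folklore] -/
theorem soloInformed_sa_modulusFactors {m : ℝ} (hm : m ∈ Ioo (0:ℝ) 1) (hma : IsAlgebraic ℚ m) :
    IsSemialgebraicFunOn ℚ {x : Fin 1 → ℝ | x 0 ∈ Ioo (0:ℝ) 1} (fun x : Fin 1 → ℝ => 1 - m * x 0 ^ 2) ∧
    IsSemialgebraicFunOn ℚ {x : Fin 1 → ℝ | x 0 ∈ Ioo (0:ℝ) 1}
      (fun x : Fin 1 → ℝ => (√(1 - m * x 0 ^ 2))⁻¹) := by
  have hsq := BallPeeling.isSemialgebraic_posIoo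
  have hlin : IsSemialgebraicFunOn ℚ {x : Fin 1 → ℝ | x 0 ∈ Ioo (0:ℝ) 1}
      (fun x : Fin 1 → ℝ => 1 - m * x 0 ^ 2) := by
    refine ((isSemialgebraicFunOn_const_of_isAlgebraic hsq isAlgebraic_one).sub_holds
      ((isSemialgebraicFunOn_const_of_isAlgebraic hsq hma).mul_holds
        (isSemialgebraicFunOn_aeval hsq (MvPolynomial.X 0 ^ 2)))).congr fun x _ => ?_
    simp only [Pi.sub_apply, Pi.mul_apply, map_pow, MvPolynomial.aeval_X]
  refine ⟨hlin, (IsSemialgebraicFunOn.sqrt_holds hlin).inv fun x hx => ?_⟩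
  have h : x 0 ∈ Ioo (0:ℝ) 1 := hx
  have : m * x 0 ^ 2 < 1 * 1 := by
    have := mul_lt_mul'' hm.2 (show x 0 ^ 2 < 1 by nlinarith [h.1, h.2]) hm.1.le (sq_nonneg _)
    simpa using this
  exact (Real.sqrt_pos.2 (by linarith)).ne'

/-- **The complete elliptic integral of the first kind as a representation.**  For `m ∈ (0,1)`
algebraic there is `K_m = [(0,1), ((1−x²)(1−mx²))^{-1/2}]`. [this work] -/
theorem soloInformed_exists_ellipticK_rep (m : ℝ) (hm : m ∈ Ioo (0:ℝ) 1) (hma : IsAlgebraic ℚ m) :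
    ∃ K : IntegralRep 1, K.domain = {x : Fin 1 → ℝ | x 0 ∈ Ioo (0:ℝ) 1} ∧
      ∀ x, K.integrand x = (√(1 - x 0 ^ 2))⁻¹ * (√(1 - m * x 0 ^ 2))⁻¹ := by
  have hsq := BallPeeling.isSemialgebraic_posIoo
  have hsa : IsSemialgebraicFunOn ℚ {x : Fin 1 → ℝ | x 0 ∈ Ioo (0:ℝ) 1}
      (fun x : Fin 1 → ℝ => (√(1 - x 0 ^ 2))⁻¹ * (√(1 - m * x 0 ^ 2))⁻¹) :=
    (soloInformed_sa_arcsine.mul_holds (soloInformed_sa_modulusFactors hm hma).2).congr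
      fun x _ => by simp only [Pi.mul_apply]
  have hint : IntegrableOn (fun x : Fin 1 → ℝ => (√(1 - x 0 ^ 2))⁻¹ * (√(1 - m * x 0 ^ 2))⁻¹)
      {x : Fin 1 → ℝ | x 0 ∈ Ioo (0:ℝ) 1} := by
    refine soloInformed_integrableOn_of_le_inv_sqrt_prod hsq hsa ∅ {0} ∅ {0} ((√(1 - m))⁻¹) ∅
      measure_empty (fun x hx _ j => ?_) (fun x _ hc => ?_)
    · have h : x 0 ∈ Ioo (0:ℝ) 1 := hx
      fin_cases j
      exact h
    · have hx := hc 0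
      have h1 := soloInformed_inv_sqrt_one_sub_sq_le hx
      have hx2 : x 0 ^ 2 ≤ 1 := by nlinarith [hx.1, hx.2]
      have hmx : 1 - m ≤ 1 - m * x 0 ^ 2 := by nlinarith [mul_le_mul_of_nonneg_left hx2 hm.1.le]
      have h2 : (√(1 - m * x 0 ^ 2))⁻¹ ≤ (√(1 - m))⁻¹ :=
        inv_anti₀ (Real.sqrt_pos.2 (by linarith [hm.2])) (Real.sqrt_le_sqrt hmx)
      have hK0 : 0 ≤ (√(1 - x 0 ^ 2))⁻¹ * (√(1 - m * x 0 ^ 2))⁻¹ := by positivity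
      have hX : 0 ≤ (√(1 - x 0))⁻¹ := by positivity
      have hb : 0 ≤ (√(1 - m * x 0 ^ 2))⁻¹ := by positivity
      rw [abs_of_nonneg hK0, Finset.prod_empty, Finset.prod_singleton]
      calc (√(1 - x 0 ^ 2))⁻¹ * (√(1 - m * x 0 ^ 2))⁻¹ ≤ (√(1 - x 0))⁻¹ * (√(1 - m))⁻¹ :=
            mul_le_mul h1 h2 hb hX
        _ ≤ (√(1 - m))⁻¹ * (1 * (√(1 - x 0))⁻¹ + 1 * (√(1 - x 0))⁻¹) := by nlinarith
  exact ⟨⟨_, _, hsq, hsa, hint⟩, rfl, fun x => rfl⟩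

/-- **The complete elliptic integral of the second kind as a representation.**  For `m ∈ (0,1)`
algebraic there is `E_m = [(0,1), (1 − mx²)·((1−x²)(1−mx²))^{-1/2}]`. [this work] -/
theorem soloInformed_exists_ellipticE_rep (m : ℝ) (hm : m ∈ Ioo (0:ℝ) 1) (hma : IsAlgebraic ℚ m) :
    ∃ E : IntegralRep 1, E.domain = {x : Fin 1 → ℝ | x 0 ∈ Ioo (0:ℝ) 1} ∧
      ∀ x, E.integrand x = (1 - m * x 0 ^ 2) * ((√(1 - x 0 ^ 2))⁻¹ * (√(1 - m * x 0 ^ 2))⁻¹) := by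
  have hsq := BallPeeling.isSemialgebraic_posIoo
  obtain ⟨hlin, hb⟩ := soloInformed_sa_modulusFactors hm hma
  have hsa : IsSemialgebraicFunOn ℚ {x : Fin 1 → ℝ | x 0 ∈ Ioo (0:ℝ) 1}
      (fun x : Fin 1 → ℝ => (1 - m * x 0 ^ 2) * ((√(1 - x 0 ^ 2))⁻¹ * (√(1 - m * x 0 ^ 2))⁻¹)) :=
    (hlin.mul_holds (soloInformed_sa_arcsine.mul_holds hb)).congr
      fun x _ => by simp only [Pi.mul_apply]
  have hint : IntegrableOn
      (fun x : Fin 1 → ℝ => (1 - m * x 0 ^ 2) * ((√(1 - x 0 ^ 2))⁻¹ * (√(1 - m * x 0 ^ 2))⁻¹))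
      {x : Fin 1 → ℝ | x 0 ∈ Ioo (0:ℝ) 1} := by
    obtain ⟨K, hKd, hKi⟩ := soloInformed_exists_ellipticK_rep m hm hma
    have hI := K.integrableOn
    rw [hKd, funext hKi] at hI
    refine Integrable.mono' hI
      (aestronglyMeasurable_of_isSemialgebraicFunOn hsa (IsSemialgebraic.measurableSet_holds hsq))
      ((ae_restrict_iff' (IsSemialgebraic.measurableSet_holds hsq)).2 (ae_of_all _ fun x hx => ?_))
    have h : x 0 ∈ Ioo (0:ℝ) 1 := hx
    have hK0 : 0 ≤ (√(1 - x 0 ^ 2))⁻¹ * (√(1 - m * x 0 ^ 2))⁻¹ := by positivity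
    have hN : |1 - m * x 0 ^ 2| ≤ 1 := by
      rw [abs_le]; constructor <;> nlinarith [hm.1, hm.2, h.1, h.2, mul_pos hm.1 (mul_pos h.1 h.1)]
    rw [Real.norm_eq_abs, abs_mul, abs_of_nonneg hK0]
    calc |1 - m * x 0 ^ 2| * ((√(1 - x 0 ^ 2))⁻¹ * (√(1 - m * x 0 ^ 2))⁻¹)
        ≤ 1 * ((√(1 - x 0 ^ 2))⁻¹ * (√(1 - m * x 0 ^ 2))⁻¹) :=
          mul_le_mul_of_nonneg_right hN hK0
      _ = _ := one_mul _
  exact ⟨⟨_, _, hsq, hsa, hint⟩, rfl, fun x => rfl⟩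

/-- **The arcsine differential as a representation**: `[(0,1), (1−x²)^{-1/2}]`. [this work] -/
theorem soloInformed_exists_arcsine_rep :
    ∃ A : IntegralRep 1, A.domain = {x : Fin 1 → ℝ | x 0 ∈ Ioo (0:ℝ) 1} ∧
      ∀ x, A.integrand x = (√(1 - x 0 ^ 2))⁻¹ := by
  have hsq := BallPeeling.isSemialgebraic_posIoo
  have hint : IntegrableOn (fun x : Fin 1 → ℝ => (√(1 - x 0 ^ 2))⁻¹)
      {x : Fin 1 → ℝ | x 0 ∈ Ioo (0:ℝ) 1} := by
    refine soloInformed_integrableOn_of_le_inv_sqrt_prod hsq soloInformed_sa_arcsine ∅ {0} ∅ {0} 1 ∅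
      measure_empty (fun x hx _ j => ?_) (fun x _ hc => ?_)
    · have h : x 0 ∈ Ioo (0:ℝ) 1 := hx
      fin_cases j
      exact h
    · have h1 := soloInformed_inv_sqrt_one_sub_sq_le (hc 0)
      have hK0 : 0 ≤ (√(1 - x 0 ^ 2))⁻¹ := by positivity
      rw [abs_of_nonneg hK0, Finset.prod_empty, Finset.prod_singleton]
      linarith
  exact ⟨⟨_, _, hsq, soloInformed_sa_arcsine, hint⟩, rfl, fun x => rfl⟩

/-! ### `2·⟦arcsine⟧ = ⟦π⟧` -/

/-- **`2·⟦[(0,1), (1−x²)^{-1/2}]⟧ = ⟦π⟧`** in the formal period ring: the substitution `u = x²`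
(rule 2) turns the arcsine representation into `½·[(0,1), u^{-1/2}(1−u)^{-1/2}] = ½·B(½,½)`, and
`⟦B(½,½)⟧ = ⟦π⟧` (Euler–lemniscate theorem, s22). [this work] -/
theorem soloInformed_two_mul_toFormalPeriod_arcsine (A : IntegralRep 1)
    (hAd : A.domain = {x : Fin 1 → ℝ | x 0 ∈ Ioo (0:ℝ) 1})
    (hAi : EqOn A.integrand (fun x => (√(1 - x 0 ^ 2))⁻¹) A.domain) :
    2 * toFormalPeriod (of A) = toFormalPeriod (of KZ.piRep) := by
  have hsq := BallPeeling.isSemialgebraic_posIoo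
  obtain ⟨H, hHd, hHi⟩ := exists_betaRep' (1/2) (1/2) (by norm_num) (by norm_num)
  have ha₂ : IsAlgebraic ℚ ((((1:ℕ):ℝ) + 1)⁻¹) := by
    have h := (isAlgebraic_nat (R := ℚ) (A := ℝ) 2).inv
    norm_num at h ⊢
    exact h
  -- the substitution `u = x²`
  have hcov : of A - of (H.constMul _ ha₂) ∈ changeOfVariablesRel := by
    refine soloInformed_lift_mem_changeOfVariablesRel A (H.constMul _ ha₂) (g := fun x => x ^ 2)
      (g' := fun x => 2 * x) (S := Ioo (0:ℝ) 1) (T := Ioo (0:ℝ) 1) hAd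
      (by rw [IntegralRep.domain_constMul, hHd]) ?_ (fun t _ => soloInformed_hasDerivAt_sq t)
      ?_ ?_ ?_
    · rw [hAd]
      refine IsSemialgebraicMapOn.of_forall hsq fun j => ?_
      refine (isSemialgebraicFunOn_aeval hsq (MvPolynomial.X 0 ^ 2)).congr fun x _ => ?_
      simp only [map_pow, MvPolynomial.aeval_X, soloInformedLift]
    · intro a ha b hb h
      have h' : a ^ 2 = b ^ 2 := h
      calc a = √(a ^ 2) := (Real.sqrt_sq ha.1.le).symm
        _ = √(b ^ 2) := by rw [h']
        _ = b := Real.sqrt_sq hb.1.le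
    · ext u
      constructor
      · rintro ⟨x, hx, rfl⟩
        exact ⟨by positivity [hx.1], by nlinarith [hx.1, hx.2]⟩
      · intro hu
        refine ⟨√u, ⟨Real.sqrt_pos.2 hu.1, ?_⟩, Real.sq_sqrt hu.1.le⟩
        rw [Real.sqrt_lt' one_pos, one_pow]
        exact hu.2
    · intro x hx
      have hx0 : x 0 ∈ Ioo (0:ℝ) 1 := by rw [hAd] at hx; exact hx
      have h1 : 0 < 1 - x 0 ^ 2 := by nlinarith [hx0.1, hx0.2]
      have hx0' : x 0 ≠ 0 := hx0.1.ne'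
      have hs' : √(1 - x 0 ^ 2) ≠ 0 := (Real.sqrt_pos.2 h1).ne'
      have e1 : (x 0 ^ 2) ^ (((1/2:ℚ):ℝ) - 1) = (x 0)⁻¹ := by
        rw [← Real.rpow_natCast (x 0) 2, ← Real.rpow_mul hx0.1.le]
        norm_num
        exact Real.rpow_neg_one (x 0)
      rw [hAi hx]
      simp only [IntegralRep.integrand_constMul, hHi, soloInformedLift]
      rw [e1, ← soloInformed_inv_sqrt_eq_rpow h1, abs_of_pos (by linarith [hx0.1]), Nat.cast_one]
      field_simp
      ring
  have e1 : toFormalPeriod (of A) = toFormalPeriod (of (H.constMul _ ha₂)) :=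
    toFormalPeriod_eq_iff.mpr (changeOfVariablesRel_subset_relations hcov)
  have e2 := toFormalPeriod_of_constMul _ ha₂ H
  have e3 : toFormalPeriod (of KZ.piRep) = toFormalPeriod (of H) :=
    soloInformed_toFormalPeriod_piRep_eq_betaHalf H hHd (by rw [hHi]; exact fun _ _ => rfl)
  have e4 := natCast_add_one_mul_toFormalPeriod_of_unit_constMul_inv 1 ha₂
  rw [Nat.cast_one, one_add_one_eq_two] at e4
  calc 2 * toFormalPeriod (of A)
      = (2 * toFormalPeriod (of (IntegralRep.unit.constMul _ ha₂))) * toFormalPeriod (of H) := by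
        rw [e1, e2, mul_assoc]
    _ = toFormalPeriod (of KZ.piRep) := by rw [e4, one_mul, e3]

/-! ### Products of one-dimensional representations over `(0,1)` -/

/-- The Fubini product of two representations on `(0,1)` with integrands `f(x)`, `g(x)` is a
representation on `(0,1)²` with integrand `f(s)g(t)`. [cite: KontsevichZagier2001, §4.1] -/
theorem soloInformed_prod_one_one (r s : IntegralRep 1) (f g : ℝ → ℝ)
    (hrd : r.domain = {x : Fin 1 → ℝ | x 0 ∈ Ioo (0:ℝ) 1})
    (hsd : s.domain = {x : Fin 1 → ℝ | x 0 ∈ Ioo (0:ℝ) 1})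
    (hri : ∀ x ∈ r.domain, r.integrand x = f (x 0))
    (hsi : ∀ x ∈ s.domain, s.integrand x = g (x 0)) :
    (r.prod s).domain = {z : Fin 2 → ℝ | z 0 ∈ Ioo (0:ℝ) 1 ∧ z 1 ∈ Ioo (0:ℝ) 1} ∧
    ∀ z : Fin 2 → ℝ, z 0 ∈ Ioo (0:ℝ) 1 ∧ z 1 ∈ Ioo (0:ℝ) 1 →
      (r.prod s).integrand z = f (z 0) * g (z 1) := by
  have hc0 : Fin.castAdd 1 (0 : Fin 1) = (0 : Fin 2) := by decide
  have hn0 : Fin.natAdd 1 (0 : Fin 1) = (1 : Fin 2) := by decide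
  constructor
  · rw [IntegralRep.prod_domain]
    ext z
    simp only [IntegralRep.mem_prodDomain, hrd, hsd, mem_setOf_eq, hc0, hn0]
  · intro z hz
    have h1 : (fun i : Fin 1 => z (Fin.castAdd 1 i)) ∈ r.domain := by
      rw [hrd]; show z (Fin.castAdd 1 (0 : Fin 1)) ∈ Ioo (0:ℝ) 1; rw [hc0]; exact hz.1
    have h2 : (fun j : Fin 1 => z (Fin.natAdd 1 j)) ∈ s.domain := by
      rw [hsd]; show z (Fin.natAdd 1 (0 : Fin 1)) ∈ Ioo (0:ℝ) 1; rw [hn0]; exact hz.2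
    rw [IntegralRep.prod_integrand_eq, IntegralRep.prodFun_apply, hri _ h1, hsi _ h2]
    show f (z (Fin.castAdd 1 (0 : Fin 1))) * g (z (Fin.natAdd 1 (0 : Fin 1))) = f (z 0) * g (z 1)
    rw [hc0, hn0]

/-- `⟦[(0,1), 1]⟧ = 1` in the formal period ring (`B(1,1) ∼ [pt, 1]`). [cite: KontsevichZagier2001, §1.2] -/
theorem soloInformed_exists_unitInterval_rep :
    ∃ I : IntegralRep 1, I.domain = {x : Fin 1 → ℝ | x 0 ∈ Ioo (0:ℝ) 1} ∧
      (∀ x ∈ I.domain, I.integrand x = 1) ∧ toFormalPeriod (of I) = 1 := by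
  obtain ⟨I, hId, hIi⟩ := exists_betaRep' 1 1 one_pos one_pos
  have h1 : IsAlgebraic ℚ (((1:ℚ):ℝ)⁻¹) := by
    rw [Rat.cast_one, inv_one]; exact isAlgebraic_one
  have hIu := betaFirst_equivalent_unit_constMul 1 one_pos I hId (by rw [hIi]; exact fun _ _ => rfl) h1
  have hu : of (IntegralRep.unit.constMul (((1:ℚ):ℝ)⁻¹) h1) - of IntegralRep.unit ∈ relations :=
    of_sub_of_mem_relations_of_eqOn (by simp) fun z _ => by simp
  refine ⟨I, hId, fun x hx => ?_, ?_⟩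
  · rw [hId] at hx
    have h : x 0 ∈ Ioo (0:ℝ) 1 := hx
    rw [hIi]
    simp
  · rw [hIu.toFormalPeriod_eq, toFormalPeriod_eq_iff.mpr hu, toFormalPeriod_of_unit]

end Summit.KontsevichZagierPeriods.KontsevichZagierPeriods.Theorems

end
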